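import Summits.QuantumAdvantage.QuantumAdvantage.Theorems.CharDialSpreadRank
import Summits.QuantumAdvantage.QuantumAdvantage.Theorems.CharDialUnreadTwist
import Summits.QuantumAdvantage.AdviceFreeQNC0.AffBells23WalkHardGen
import Summits.QuantumAdvantage.AdviceFreeQNC0.AffBells22WalkHardAllSubcube
import Summits.QuantumAdvantage.AdviceFreeQNC0.AffBells22SubcubeWalk
import Summits.QuantumAdvantage.AdviceFreeQNC0.BlockCombJoin37
import Summits.QuantumAdvantage.AdviceFreeQNC0.PredHard
import Summits.QuantumAdvantage.AdviceFreeQNC0.WalkHardFJuntaCuts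
import Summits.QuantumAdvantage.AdviceFreeQNC0.LinearSelections
import Mathlib.Analysis.SpecialFunctions.Complex.CircleAddChar
import Mathlib.NumberTheory.LegendreSymbol.AddCharacter
import Mathlib.Analysis.Normed.Ring.Finite
import HarnessLib

/-!
# Junta ⊕ linear-form strategies of EVERY FINITE RANK lose α's u-walk game (SliceDial rev 13: `L_r` for all `r`)

decomp-qadv lens-6 («barrier-complement carving») g12, tree part 19.  Prop-free, sorry-free.  IMPORTS part 18
`CharDialSpreadRank.lean` (the `r`-form dial `WindowCounter.formStratR`, `vecF`, `comb`, `linF_comb`, `ite_eq_sum_charR`,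
`JLinPeel.strat_eq_formStratR`), hence parts 14/16 (`WindowCounter.linF`, `setBlk`, `kappaF`, the character / block-product
lemmas `norm_pair_le`, `exists_prod_sgn_eq`, `sum_msum_avg`, `exists_indep`, …), the landed `Theorems.CharDialJLinPeel`
(`JLinData`, `winCount`), `CharDialJLinSlice` (`JLinPeel.sum_card_subcube`), `CharDialUnreadTwist` (`UnreadTwist.ringWinU_congr`)
and the tree rungs `AffBells23WalkHardGen` (`ringWinGen`, `walkHardGen`), `AffBells22SubcubeWalk` / `AffBells22WalkHardAllSubcube`
(`Subcube.emb/ext/res/idx/cut`, `subcubeMerge`, `card_filter_merge_le`), `BlockCombJoin37` (`BlockFibre37.hasDeg_of_dependsOn`),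
`PredHard` (`DWalk.const_mul_logPow_le'`), `LinearSelections` (`WalkHardFLinSel`).

CONTENT (the node's §22–§25 verbatim, re-namespaced; §26's R5 link spelled out).
* §22 (namespace `…AdviceFreeQNC0.SubcubeBells`): TRANSPORT of the u-walk game on a coordinate subcube `{u_W = β_W}` to the
  tree's GENERALISED-BELL game on the free cube — `walkExp_ext`, **`ringWinU_ext : ringWinU c y (ext W β v) =
  ringWinGen (cut W ·) (c + · + (wW + pW ·)) (y · (ext W β ·)) v`**, `junta_ext`, `card_supp_res`, `merge_*`.
* §23 (namespace `…AdviceFreeQNC0.WindowCounter`, sections GenBlock / FormJuntaG): the CLASS-CONDITIONED BLOCK PRODUCT for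
  generalised bells with arbitrary positions `pat b`, phases `κ b` and junta bound `L` — `firesG`, `touchG`, `QfG`,
  `QfG_exchange`, `norm_QfG_pair_le`, `norm_sum_QfG_le ≤ 2ⁿ·κ_F(p)^M`, `card_touchG_le`, `sum_degG_le`, `exists_blocksG`,
  **`formJunta_smallG (hp : 5 ≤ p)`**: `∀ ε > 0, ∃ Q, ∀ n m L pat κ a y, (L-juntas) → Q·(m(L+1)² + n) ≤ n² → Q ≤ n → n ≤ 2·#supp a →
  ∀ t ≠ 0, ‖A₁^{ta}(y)‖ ≤ ε·2ⁿ`.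
* §24 (section SpreadFormG): the `r`-FORM DIAL of a generalised-bell game, `formStratRG`, its Fourier reduction over `(ℤ/p)^r`
  (`card_win_formRG_eq_sum`, `class_count_le_formRG`), the main term `genMain` ⟸ `AffBells23.walkHardGen` (`C = 2`, uniform in
  the number of bells, the positions and the phases), `log_le_sq_log`, and **`form_reductionRG (hp) : ∃ θ₁ < 1, ∀ r K, ∃ N₀,
  ∀ N ≥ N₀, ∀ m ≤ K·N, ∀ pat κ A Y, (every nonzero combination dense) → ((log₂ N)²-junta classes) → #WinGen ≤ θ₁·2^N`** — ONE
  rate for every rank `r` and every bell budget `K`.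
* §25 (namespace `…AdviceFreeQNC0.JLinPeel`, section SubRank): the SUBCUBE RANK INDUCTION — `linF_ext`, `vecF_ext`,
  `subRank_dense`, **`subRank_hard (hp) : ∃ θ < 1, ∀ r K, ∃ n₀, ∀ n ≥ n₀, ∀ W β c A Y, n ≤ K·(n − |W|) → (log₂ n-juntas) →
  #{u | ringWinU c (formStratR p A Y) (subcubeMerge W β u)} ≤ θ·2ⁿ`** (induction on `r` generalizing `K`: if every nonzero
  combination of the directions is dense on the free coordinates, transport + `form_reductionRG`; else slice on the support
  of a sparse combination, `K ↦ 2K`, and RE-PRESENT the classes through `Φ = Fin.insertNth j₀ (t_{j₀}⁻¹·(σ − Σ_j t_j s'_j))`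
  so that the sparse combination is constant on every finer subcube and the data has rank `r − 1`; fibres summed by
  `sum_card_subcube`), `rankR_hard` (`W = ∅`, `K = 1`).  Section RankCorollaries: **`rankLe_hard_unif`** / **`rankLe_hard`**
  — for every prime `p ≥ 5`, ONE `θ < 1` such that for every `r`, eventually in `n`, every `D : JLinData p n` with
  `log₂ n`-juntas whose non-blind cuts' forms lie in the span of ANY `r` directions (sparse, dense or mixed — no spread
  hypothesis: this removes the well-spread hypothesis of part 18's `spreadRank_hard`) wins α's u-walk game on at most `θ·2ⁿ`
  inputs; and the R5 link **`walkHardFLinSel_of_jLinHard`**: hardness for ALL `log₂ n`-junta ⊕ form data at `p` (CharDial's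
  item 32604 at the prime `p`, spelled) implies the tree rung `WalkHardFLinSel p` (pure linear tests).
In the node (`Theses.SliceDial`, workshop) these give `RankLeHard p r` / `SemRankLeHard p r` for every `r`, hence
`32604@p ⟺ SemRankGtHard p r` for every `r`: the residual of the slice dial is unbounded rank only.
-/

noncomputable section

open Finset
open Summit.QuantumAdvantage.AdviceFreeQNC0 Summit.QuantumAdvantage.AdviceFreeQNC0.JLinPeel

/-! # §22 THE SUBCUBE TRANSPORT: a coordinate subcube of the walk game is a GENERALISED-BELL game
on the free cube (tree `AffBells23.ringWinGen`), with the junta, the linear forms and the support densities carried along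

On the subcube `{u_W = β_W}` with free coordinates enumerated increasingly by the tree's `Subcube.emb W`
(`N = n − |W|` of them), the walk exponent of cut `g` splits as a constant plus the free walk exponent at the free
position `Subcube.cut W g` (`walkExp_ext`, the tree's stated-only `AffBells23.WalkExpSplit` in `Subcube` terms), so
`ringWinU c y (ext W β v) = ringWinGen (cut W ·) (c + · + const) (y · (ext W β ·)) v` (`ringWinU_ext`); a `J`-junta
table is a junta of at most `|J|` free bits (`junta_ext`), a linear form is a constant plus the restricted form
(`linF_ext`), and relative supports are supports of restrictions (`card_supp_res`). -/

namespace Summit.QuantumAdvantage.AdviceFreeQNC0.SubcubeBells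

open AffBells22 AffBells23 Subcube

variable {n : ℕ} (W : Finset (Fin n)) (β : Fin n → Bool)

/-- the number of `1`s of the fixed part. -/
def wW : ℕ := (W.filter fun i => β i = true).card

/-- the number of `1`s of the fixed part before cut `g`. -/
def pW (g : ℕ) : ℕ := (W.filter fun i => i.val < g ∧ β i = true).card

/-- **splitting a Boolean-indicator sum at an extended point** into its fixed part and its free part. -/
theorem sum_ext_split {M : Type*} [AddCommMonoid M] (v : Fin (n - W.card) → Bool) (G : Fin n → M) :
    (∑ i, if ext W β v i = true then G i else 0) =
      (∑ i ∈ W, if β i = true then G i else 0) + ∑ j : Fin (n - W.card), if v j = true then G (emb W j) else 0 := by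
  classical
  rw [← Finset.sum_add_sum_compl W (fun i => if ext W β v i = true then G i else 0)]
  congr 1
  · exact sum_congr rfl fun i hi => by rw [ext_of_mem W β v hi]
  · have hmap : (Wᶜ : Finset (Fin n)) = univ.map ((Wᶜ).orderEmbOfFin (card_compl_eq W)).toEmbedding :=
      (Finset.map_orderEmbOfFin_univ _ _).symm
    rw [hmap, Finset.sum_map]
    refine sum_congr rfl fun j _ => ?_
    have e : ((Wᶜ).orderEmbOfFin (card_compl_eq W)).toEmbedding j = emb W j := rfl
    rw [e, ext_emb]

/-- the weight of an extended point. -/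
theorem wt_ext (v : Fin (n - W.card) → Bool) : wt (ext W β v) = wW W β + wt v := by
  have h := sum_ext_split W β v (fun _ => (1 : ℕ))
  simp only [wt, wW, card_eq_sum_ones, sum_filter]
  simpa using h

/-- the prefix weights of an extended point. -/
theorem wtPrefix_ext (v : Fin (n - W.card) → Bool) (g : ℕ) :
    wtPrefix (ext W β v) g = pW W β g + wtPrefix v (cut W g) := by
  have h := sum_ext_split W β v (fun i => if i.val < g then (1 : ℕ) else 0)
  have e1 : wtPrefix (ext W β v) g = ∑ i : Fin n, if ext W β v i = true then (if i.val < g then 1 else 0) else 0 := by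
    unfold wtPrefix; rw [card_eq_sum_ones, sum_filter]
    refine sum_congr rfl fun i _ => ?_
    by_cases h1 : ext W β v i = true <;> by_cases h2 : i.val < g <;> simp [h1, h2]
  have e2 : pW W β g = ∑ i ∈ W, if β i = true then (if i.val < g then 1 else 0) else 0 := by
    unfold pW; rw [card_eq_sum_ones, sum_filter]
    refine sum_congr rfl fun i _ => ?_
    by_cases h1 : β i = true <;> by_cases h2 : i.val < g <;> simp [h1, h2]
  have e3 : wtPrefix v (cut W g) = ∑ j : Fin (n - W.card), if v j = true then (if (emb W j).val < g then 1 else 0) else 0 := by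
    unfold wtPrefix; rw [card_eq_sum_ones, sum_filter]
    refine sum_congr rfl fun j _ => ?_
    have hiff := emb_lt_iff W g j
    by_cases h1 : v j = true <;> by_cases h2 : (emb W j).val < g
    · simp [h1, h2, hiff.1 h2]
    · have : ¬ (j.val < cut W g) := fun h' => h2 (hiff.2 h'); simp [h1, h2, this]
    · simp [h1]
    · simp [h1]
  rw [e1, e2, e3]; exact h

/-- **the walk-exponent splitting** (the tree's `AffBells23.WalkExpSplit`, in `Subcube` coordinates). -/
theorem walkExp_ext (v : Fin (n - W.card) → Bool) (g : ℕ) :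
    walkExp (ext W β v) g = (wW W β + pW W β g) + walkExp v (cut W g) := by
  unfold walkExp; rw [wt_ext, wtPrefix_ext]; ring

/-- **a subcube of the walk game is a generalised-bell game on the free bits**: bell `g` sits at the free position
`cut W g` with phase `c + g + (fixed weight + fixed prefix weight)`. -/
theorem ringWinU_ext (c : ℕ) (y : Fin (n + 1) → (Fin n → Bool) → Bool) (v : Fin (n - W.card) → Bool) :
    ringWinU c y (ext W β v) =
      ringWinGen (fun g : Fin (n + 1) => cut W g.val) (fun g : Fin (n + 1) => c + g.val + (wW W β + pW W β g.val))
        (fun g v => y g (ext W β v)) v := by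
  simp only [ringWinU, ringWinGen, walkExp_ext, Nat.add_assoc]

/-- a `J`-junta of the full cube is, at extended points, a junta of the free bits sitting under `J`. -/
theorem junta_ext {J : Finset (Fin n)} {S : Type*} {f : (Fin n → Bool) → S}
    (hf : ∀ u u' : Fin n → Bool, (∀ i ∈ J, u i = u' i) → f u = f u') :
    ∃ J' : Finset (Fin (n - W.card)), J'.card ≤ J.card ∧
      ∀ v v' : Fin (n - W.card) → Bool, (∀ j ∈ J', v j = v' j) → f (ext W β v) = f (ext W β v') := by
  classical
  refine ⟨univ.filter fun j => emb W j ∈ J, ?_, fun v v' hvv => hf _ _ fun i hi => ?_⟩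
  · calc (univ.filter fun j : Fin (n - W.card) => emb W j ∈ J).card
        = ((univ.filter fun j : Fin (n - W.card) => emb W j ∈ J).image (emb W)).card :=
          (card_image_of_injective _ (emb_strictMono W).injective).symm
      _ ≤ J.card := card_le_card (by
          intro i hi
          rw [mem_image] at hi
          obtain ⟨j, hj, rfl⟩ := hi
          exact (mem_filter.1 hj).2)
  · by_cases hiW : i ∈ W
    · rw [ext_of_mem W β v hiW, ext_of_mem W β v' hiW]
    · have e := emb_idx W i hiW
      have hj : idx W i hiW ∈ univ.filter (fun j : Fin (n - W.card) => emb W j ∈ J) :=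
        mem_filter.2 ⟨mem_univ _, by rw [e]; exact hi⟩
      have h1 : ext W β v i = v (idx W i hiW) := by
        conv_lhs => rw [← e]
        exact ext_emb W β v _
      have h2 : ext W β v' i = v' (idx W i hiW) := by
        conv_lhs => rw [← e]
        exact ext_emb W β v' _
      rw [h1, h2, hvv _ hj]

/-- **relative supports are supports of restrictions.** -/
theorem card_supp_res {M : Type*} [Zero M] [DecidableEq M] (a : Fin n → M) :
    (univ.filter fun j : Fin (n - W.card) => res W a j ≠ 0).card =
      (univ.filter fun i : Fin n => i ∉ W ∧ a i ≠ 0).card := by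
  classical
  rw [← card_image_of_injective (univ.filter fun j : Fin (n - W.card) => res W a j ≠ 0) (emb_strictMono W).injective]
  congr 1
  ext i
  simp only [mem_image, mem_filter, mem_univ, true_and, res]
  constructor
  · rintro ⟨j, hj, rfl⟩
    exact ⟨emb_not_mem W j, hj⟩
  · rintro ⟨hiW, hai⟩
    exact ⟨idx W i hiW, by rw [emb_idx]; exact hai, emb_idx W i hiW⟩

/-- nested merges: fixing `W` inside a point already fixed on `W' ⊇ W` is one merge on `W'`. -/
theorem merge_merge_of_subset {W W' : Finset (Fin n)} (hWW : W ⊆ W') (β β' u : Fin n → Bool) :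
    subcubeMerge W β (subcubeMerge W' β' u) = subcubeMerge W' (subcubeMerge W β β') u := by
  funext i
  by_cases hi : i ∈ W
  · simp [subcubeMerge, hi, hWW hi]
  · by_cases hi' : i ∈ W'
    · simp [subcubeMerge, hi, hi']
    · simp [subcubeMerge, hi, hi']

/-- the empty merge is the identity. -/
theorem merge_empty (β u : Fin n → Bool) : subcubeMerge (∅ : Finset (Fin n)) β u = u := by
  funext i; simp [subcubeMerge]

end Summit.QuantumAdvantage.AdviceFreeQNC0.SubcubeBells

/-! # §23 THE BLOCK PRODUCT FOR GENERALISED-BELL GAMES — form-twisted win sums of junta strategies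
with ARBITRARY bell positions `pat b` and phases `κ b` (tree `AffBells23.ringWinGen`)

§I verbatim with cut `g ↦` bell `b`, position `g ↦ pat b`, phase `c + g ↦ κ b`, `n + 1` cuts `↦ m` bells: the block
overwrites, weight classes, class-restricted multi-sums and per-block factors of §I are game-independent and reused;
the sign congruence, the four-point identity, the ratio property, the block-product bound, block selection
(`Σ deg ≤ m·(L+1)²`) and the final estimate are re-proved for `ringWinGen`.  Main theorem `formJunta_smallG`:
for `L`-junta strategies, dense directions `a`, `t ≠ 0` and `Q·(m(L+1)² + n) ≤ n²`,
`‖Σ_u [WIN^{gen}_y u] ψ_p(t⟨a,u⟩)‖ ≤ ε·2ⁿ`.  Through the subcube transport (§22) this is the form-twisted bias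
RELATIVE TO A SUBCUBE that NODE-g11 «Next» 3(b) asked for. -/

namespace Summit.QuantumAdvantage.AdviceFreeQNC0.WindowCounter

open Summit.QuantumAdvantage.AdviceFreeQNC0 AffBells23

section GenBlock

variable (p : ℕ) [Fact p.Prime] {n m : ℕ}
variable (pat κ : Fin m → ℕ) (y : Fin m → (Fin n → Bool) → Bool) (J : Fin m → Finset (Fin n))

/-- bell `b` fires with a nonzero exponent. -/
def firesG (b : Fin m) (u : Fin n → Bool) : Bool :=
  decide (y b u = true ∧ (κ b + walkExp u (pat b)) % 3 ≠ 0)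

/-- CharDialSubRankA helper `prod_sgn_firesG` (decomp-qadv land package; see the module docstring). -/
theorem prod_sgn_firesG (u : Fin n → Bool) :
    ∏ b : Fin m, sgn (firesG pat κ y b u) =
      (-1) ^ (univ.filter fun b : Fin m => y b u = true ∧ (κ b + walkExp u (pat b)) % 3 ≠ 0).card := by
  have : ∀ b : Fin m, sgn (firesG pat κ y b u) =
      if (y b u = true ∧ (κ b + walkExp u (pat b)) % 3 ≠ 0) then (-1 : ℂ) else 1 := fun b => by
    unfold firesG sgn; by_cases h : (y b u = true ∧ (κ b + walkExp u (pat b)) % 3 ≠ 0) <;> simp [h]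
  simp only [this]
  rw [prod_ite, prod_const, prod_const_one, mul_one]

/-- the generalised WIN indicator through the sign product. -/
theorem win_indicatorG (u : Fin n → Bool) :
    (if ringWinGen pat κ y u = true then (1 : ℂ) else 0) = (1 - ∏ b : Fin m, sgn (firesG pat κ y b u)) / 2 := by
  rw [prod_sgn_firesG]
  unfold ringWinGen
  set k := (univ.filter fun b : Fin m => y b u = true ∧ (κ b + walkExp u (pat b)) % 3 ≠ 0).card
  rcases Nat.even_or_odd k with hk | hk
  · rw [hk.neg_one_pow, if_neg (by simpa [Nat.even_iff] using hk)]; ring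
  · rw [hk.neg_one_pow, if_pos (by simpa [Nat.odd_iff] using hk)]; ring

/-- bell `b` TOUCHES the block at `k`: it reads one of its bits, or its position sits inside it. -/
def touchG (b : Fin m) (k : ℕ) : Bool :=
  decide ((∃ i ∈ J b, k ≤ i.val ∧ i.val < k + 3) ∨ (pat b = k + 1 ∨ pat b = k + 2))

/-- **sign congruence**: a bell that does not touch the block does not notice an in-class change of its content. -/
theorem firesG_setBlk_congr (hJ : ∀ b u v, (∀ i ∈ J b, u i = v i) → y b u = y b v) {k : ℕ} (hk : k + 3 ≤ n)
    {b : Fin m} (hb : ¬ (touchG pat J b k = true)) {X X' : Fin 3 → Bool} (hXX : wt X % 3 = wt X' % 3)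
    (z : Fin n → Bool) :
    firesG pat κ y b (setBlk k X z) = firesG pat κ y b (setBlk k X' z) := by
  have hy : y b (setBlk k X z) = y b (setBlk k X' z) := hJ b _ _ fun i hi => by
    have hni : ¬ (k ≤ i.val ∧ i.val < k + 3) := fun h => hb (decide_eq_true (Or.inl ⟨i, hi, h⟩))
    rw [setBlk_of_not X z hni, setBlk_of_not X' z hni]
  have hw := wt_setBlk k hk X z
  have hw' := wt_setBlk k hk X' z
  have hgk : pat b ≤ k ∨ k + 3 ≤ pat b := by
    by_contra h; push Not at h; exact hb (decide_eq_true (Or.inr (by omega)))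
  have hP : wtPrefix (setBlk k X z) (pat b) % 3 = wtPrefix (setBlk k X' z) (pat b) % 3 := by
    rcases hgk with h | h
    · rw [(wtPrefix_setBlk k hk X z (pat b)).1 h, (wtPrefix_setBlk k hk X' z (pat b)).1 h]
    · have h1 := (wtPrefix_setBlk k hk X z (pat b)).2 h
      have h2 := (wtPrefix_setBlk k hk X' z (pat b)).2 h
      omega
  have hmod : (κ b + walkExp (setBlk k X z) (pat b)) % 3 = (κ b + walkExp (setBlk k X' z) (pat b)) % 3 := by
    unfold walkExp; omega
  unfold firesG; rw [hy, hmod]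

/-- `Q(u) = (∏_b sgn fires_b u) · ψ_p(t⟨a,u⟩)` for the generalised game. -/
def QfG (a : Fin n → ZMod p) (t : ZMod p) (u : Fin n → Bool) : ℂ :=
  (∏ b : Fin m, sgn (firesG pat κ y b u)) * (ZMod.stdAddChar (t * linF p a u) : ℂ)

/-- CharDialSubRankA helper `norm_QfG` (decomp-qadv land package; see the module docstring). -/
theorem norm_QfG (a : Fin n → ZMod p) (t : ZMod p) (u : Fin n → Bool) : ‖QfG p pat κ y a t u‖ = 1 := by
  unfold QfG
  obtain ⟨b, hb⟩ := exists_prod_sgn_eq (univ : Finset (Fin m)) (fun b => firesG pat κ y b u)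
  rw [norm_mul, hb, norm_sgn, norm_char, one_mul]

/-- CharDialSubRankA helper `QfG_ne_zero` (decomp-qadv land package; see the module docstring). -/
theorem QfG_ne_zero (a : Fin n → ZMod p) (t : ZMod p) (u : Fin n → Bool) : QfG p pat κ y a t u ≠ 0 := by
  intro h; have := norm_QfG p pat κ y a t u; rw [h, norm_zero] at this; exact zero_ne_one this


end GenBlock
end Summit.QuantumAdvantage.AdviceFreeQNC0.WindowCounter
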